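import Summits.AtomisticToContinuum.FouriersLaw.Theses.EmbeddedDrudeMourre
import Literature.MathematicalPhysics.KineticTheory.InfiniteChainSuperstableDynamics
import Literature.MathematicalPhysics.KineticTheory.InfiniteChainInvariantStates
import Mathlib.Analysis.Calculus.MeanValue
import Mathlib.Analysis.Calculus.IteratedDeriv.Lemmas

/-!
# drefute `stmt-AtomisticToContinuum-12597` / line `temperature-blind-vitali-hurwitz`
# Finding: `stub_thermalExponent` (K1) is REDUNDANT — the crux follows from stubs 1, 2, 4, 5 alone

Evidence file of the deep-refute seat (refuter-drefute-stmt-AtomisticToContinuum-12597-0), sorry-free.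

The registered skeleton `Lines/temperature-blind-vitali-hurwitz.lean` composes FIVE stubs; the
first-order modulus `stub_thermalExponent` (K1, size L, OPEN: `ν`-uniform bound on
`∂_T log A_T(ν)` on compacts) enters the composition `continuation_of_modulus` at exactly one
place: `factorial_bounds_of_K1_and_tower` merges it with the tower (`k ≥ 2`) to produce the
`∀ k ≥ 1` hypothesis of `stub_realVitali`.

This file proves (pure real analysis, mean value theorem only):

* `realVitali_two_of_one` : the statement of `stub_realVitali` (factorial bounds for `k ≥ 1`)
  IMPLIES the same statement with bounds assumed only for `k ≥ 2` (`RealVitali 1 → RealVitali 2`).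
  Mechanism: convergence at two corner points `T₀/3`, `2T₀/3` + the `k = 2` bound (equi-Lipschitz
  derivatives) give, by the mean value theorem, an EVENTUAL (`ν ∈ (0, δ]`) uniform bound on the
  first derivative on every compact; the vanishing parameter is then rescaled `ν ↦ δν`
  (`𝓝[>] 0`-invariant) so that "eventually" becomes "for all `ν ∈ (0,1]`", and the `k ≥ 1` lemma
  applies to the rescaled family.
* `continuation_without_K1` : the crux, unfolded, from the statements of `stub_thermalFamily`,
  `stub_canonicalSeed`, `stub_logGevreyTower`, `stub_realVitali` ONLY (the skeleton's composition
  with `hK` deleted), and `GreenKuboContinuation_of_four` concluding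
  `EmbeddedDrudeMourre.GreenKuboContinuation` by name from those four statements.

Consequence for the lead: `stub_thermalExponent` can be dropped from the stub set (reshape:
`GreenKuboContinuation_of := continuation_without_K1 stub_thermalFamily stub_canonicalSeed
stub_logGevreyTower stub_realVitali`); K1 is not an independent milestone of THIS line — given the
tower and the corner seed, a `ν`-EVENTUAL first-order bound is automatic. (The same argument
iterated shows that for any fixed `k₀` the bounds of orders `< k₀` are eventually implied by those
of orders `≥ k₀` plus corner convergence: only the factorial GROWTH RATE of the tower, uniformly in
`ν`, is load-bearing.)
-/

noncomputable section

namespace Summit.AtomisticToContinuum.FouriersLaw.Cruxes.GreenKuboContinuation.Drefute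

open Filter Topology MeasureTheory Set
open Literature.MathematicalPhysics.KineticTheory.HeatConduction

/-- The real-variable Vitali propagation statement with factorial bounds assumed for orders
`k ≥ k₀`. `RealVitali 1` is LITERALLY the statement of `stub_realVitali` (see the `example`
below); `RealVitali 2` is the stronger lemma (weaker hypothesis) that makes K1 unnecessary. -/
def RealVitali (k₀ : ℕ) : Prop :=
  ∀ (g : ℝ → ℝ → ℝ) (T₀ : ℝ), 0 < T₀ →
    (∀ ν : ℝ, 0 < ν → ν ≤ 1 → ∀ k : ℕ, DifferentiableOn ℝ (iteratedDeriv k (g ν)) (Set.Ioi 0)) →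
    (∀ a b : ℝ, 0 < a → a < b → ∃ C : ℝ, 0 < C ∧ ∀ ν : ℝ, 0 < ν → ν ≤ 1 →
      ∀ k : ℕ, k₀ ≤ k → ∀ T ∈ Set.Icc a b,
        |iteratedDeriv k (g ν) T| ≤ C ^ (k + 1) * (k.factorial : ℝ)) →
    (∀ T : ℝ, 0 < T → T < T₀ →
      ∃ L : ℝ, Filter.Tendsto (fun ν : ℝ => g ν T) (nhdsWithin (0:ℝ) (Set.Ioi 0)) (nhds L)) →
    ∀ T : ℝ, 0 < T →
      ∃ L : ℝ, Filter.Tendsto (fun ν : ℝ => g ν T) (nhdsWithin (0:ℝ) (Set.Ioi 0)) (nhds L)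

/-- `RealVitali 1` is syntactically the statement of `stub_realVitali`. -/
example : RealVitali 1 ↔
    (∀ (g : ℝ → ℝ → ℝ) (T₀ : ℝ), 0 < T₀ →
      (∀ ν : ℝ, 0 < ν → ν ≤ 1 → ∀ k : ℕ, DifferentiableOn ℝ (iteratedDeriv k (g ν)) (Set.Ioi 0)) →
      (∀ a b : ℝ, 0 < a → a < b → ∃ C : ℝ, 0 < C ∧ ∀ ν : ℝ, 0 < ν → ν ≤ 1 →
        ∀ k : ℕ, 1 ≤ k → ∀ T ∈ Set.Icc a b,
          |iteratedDeriv k (g ν) T| ≤ C ^ (k + 1) * (k.factorial : ℝ)) →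
      (∀ T : ℝ, 0 < T → T < T₀ →
        ∃ L : ℝ, Filter.Tendsto (fun ν : ℝ => g ν T) (nhdsWithin (0:ℝ) (Set.Ioi 0)) (nhds L)) →
      ∀ T : ℝ, 0 < T →
        ∃ L : ℝ, Filter.Tendsto (fun ν : ℝ => g ν T) (nhdsWithin (0:ℝ) (Set.Ioi 0)) (nhds L)) :=
  Iff.rfl

/-- Rescaling the vanishing parameter: `ν ↦ c ν` maps `𝓝[>] 0` into itself for `c > 0`. -/
theorem tendsto_const_mul_nhdsGT {c : ℝ} (hc : 0 < c) :
    Tendsto (fun ν : ℝ => c * ν) (𝓝[>] (0:ℝ)) (𝓝[>] (0:ℝ)) := by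
  refine tendsto_nhdsWithin_iff.2 ⟨?_, ?_⟩
  · have h : Tendsto (fun ν : ℝ => c * ν) (𝓝 (0:ℝ)) (𝓝 (c * 0)) :=
      tendsto_const_nhds.mul tendsto_id
    rw [mul_zero] at h
    exact h.mono_left nhdsWithin_le_nhds
  · filter_upwards [self_mem_nhdsWithin] with ν hν
    exact mul_pos hc hν

/-- `iteratedDeriv 2 f = deriv (deriv f)`. -/
theorem iteratedDeriv_two_eq (f : ℝ → ℝ) : iteratedDeriv 2 f = deriv (deriv f) := by
  rw [iteratedDeriv_succ, iteratedDeriv_one]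

/-- MEAN-VALUE BOUND ON THE FIRST DERIVATIVE. If `f` is differentiable on `(0,∞)` with `deriv f`
differentiable there and `|f''| ≤ M` on `[a', b'] ∋ T₁ < T₂`, then for every `x ∈ [a', b']`,
`|f'(x)| ≤ (|f T₂| + |f T₁|)/(T₂ - T₁) + M (b' - a')`. -/
theorem abs_deriv_le_of_two_points {f : ℝ → ℝ} {a' b' T₁ T₂ M : ℝ}
    (ha' : 0 < a') (h1 : a' ≤ T₁) (h12 : T₁ < T₂) (h2 : T₂ ≤ b')
    (hd0 : DifferentiableOn ℝ f (Ioi 0)) (hd1 : DifferentiableOn ℝ (deriv f) (Ioi 0))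
    (hM : ∀ y ∈ Icc a' b', |deriv (deriv f) y| ≤ M) {x : ℝ} (hx : x ∈ Icc a' b') :
    |deriv f x| ≤ (|f T₂| + |f T₁|) / (T₂ - T₁) + M * (b' - a') := by
  have hsub : Icc a' b' ⊆ Ioi (0:ℝ) := fun y hy => ha'.trans_le hy.1
  -- mean value theorem on [T₁, T₂]
  have hcont : ContinuousOn f (Icc T₁ T₂) :=
    hd0.continuousOn.mono fun y hy => hsub ⟨h1.trans hy.1, hy.2.trans h2⟩
  have hdiff : DifferentiableOn ℝ f (Ioo T₁ T₂) :=
    hd0.mono fun y hy => hsub ⟨h1.trans hy.1.le, hy.2.le.trans h2⟩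
  obtain ⟨ξ, hξ, hξeq⟩ := exists_deriv_eq_slope f h12 hcont hdiff
  have hξI : ξ ∈ Icc a' b' := ⟨h1.trans hξ.1.le, hξ.2.le.trans h2⟩
  have hpos : 0 < T₂ - T₁ := sub_pos.2 h12
  have hslope : |deriv f ξ| ≤ (|f T₂| + |f T₁|) / (T₂ - T₁) := by
    rw [hξeq, abs_div, abs_of_pos hpos]
    exact div_le_div_of_nonneg_right (abs_sub _ _) hpos.le
  -- Lipschitz bound for deriv f on the convex set [a', b']
  have hlip : ‖deriv f x - deriv f ξ‖ ≤ M * ‖x - ξ‖ :=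
    (convex_Icc a' b').norm_image_sub_le_of_norm_deriv_le
      (fun y hy => (hd1 y (hsub hy)).differentiableAt (Ioi_mem_nhds (hsub hy)))
      (fun y hy => by rw [Real.norm_eq_abs]; exact hM y hy) hξI hx
  rw [Real.norm_eq_abs, Real.norm_eq_abs] at hlip
  have hMnn : 0 ≤ M := (abs_nonneg _).trans (hM ξ hξI)
  have hdist : |x - ξ| ≤ b' - a' := by
    rw [abs_le]; constructor <;> linarith [hx.1, hx.2, hξI.1, hξI.2]
  calc |deriv f x| = |(deriv f x - deriv f ξ) + deriv f ξ| := by ring_nf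
    _ ≤ |deriv f x - deriv f ξ| + |deriv f ξ| := abs_add_le _ _
    _ ≤ M * (b' - a') + (|f T₂| + |f T₁|) / (T₂ - T₁) :=
        add_le_add (hlip.trans (mul_le_mul_of_nonneg_left hdist hMnn)) hslope
    _ = _ := by ring

/-- **K1 IS REDUNDANT IN `stub_realVitali`**: the real-Vitali statement with factorial bounds for
`k ≥ 1` implies the one with bounds only for `k ≥ 2`. -/
theorem realVitali_two_of_one (hV : RealVitali 1) : RealVitali 2 := by
  intro g T₀ hT₀ hs hb hc T hT
  -- two seed points in the corner
  obtain ⟨L₁, hL₁⟩ := hc (T₀ / 3) (by positivity) (by linarith)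
  obtain ⟨L₂, hL₂⟩ := hc (2 * T₀ / 3) (by positivity) (by linarith)
  have h12 : T₀ / 3 < 2 * T₀ / 3 := by linarith
  -- eventually the values at the seed points are bounded
  have hev : ∀ᶠ ν in 𝓝[>] (0:ℝ), |g ν (T₀ / 3)| ≤ |L₁| + 1 ∧ |g ν (2 * T₀ / 3)| ≤ |L₂| + 1 := by
    have h1 := (Metric.tendsto_nhds.1 hL₁) 1 one_pos
    have h2 := (Metric.tendsto_nhds.1 hL₂) 1 one_pos
    filter_upwards [h1, h2] with ν h1 h2
    rw [Real.dist_eq] at h1 h2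
    constructor
    · calc |g ν (T₀ / 3)| = |(g ν (T₀ / 3) - L₁) + L₁| := by ring_nf
        _ ≤ |g ν (T₀ / 3) - L₁| + |L₁| := abs_add_le _ _
        _ ≤ |L₁| + 1 := by linarith
    · calc |g ν (2 * T₀ / 3)| = |(g ν (2 * T₀ / 3) - L₂) + L₂| := by ring_nf
        _ ≤ |g ν (2 * T₀ / 3) - L₂| + |L₂| := abs_add_le _ _
        _ ≤ |L₂| + 1 := by linarith
  obtain ⟨δ₀, hδ₀pos, hδ₀⟩ := mem_nhdsGT_iff_exists_Ioc_subset.1 hev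
  have hδ₀pos' : 0 < δ₀ := hδ₀pos
  set δ : ℝ := min δ₀ 1 with hδdef
  have hδpos : 0 < δ := lt_min hδ₀pos' one_pos
  have hδν : ∀ ν : ℝ, 0 < ν → ν ≤ 1 → 0 < δ * ν ∧ δ * ν ≤ 1 ∧ δ * ν ≤ δ₀ := by
    intro ν hν hν1
    refine ⟨mul_pos hδpos hν, ?_, ?_⟩
    · calc δ * ν ≤ 1 * 1 := mul_le_mul (min_le_right _ _) hν1 hν.le zero_le_one
        _ = 1 := one_mul 1
    · calc δ * ν ≤ δ₀ * 1 := mul_le_mul (min_le_left _ _) hν1 hν.le hδ₀pos'.le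
        _ = δ₀ := mul_one δ₀
  have hbd : ∀ ν : ℝ, 0 < ν → ν ≤ 1 →
      |g (δ * ν) (T₀ / 3)| ≤ |L₁| + 1 ∧ |g (δ * ν) (2 * T₀ / 3)| ≤ |L₂| + 1 :=
    fun ν hν hν1 => hδ₀ ⟨(hδν ν hν hν1).1, (hδν ν hν hν1).2.2⟩
  -- the rescaled family  g' ν := g (δ ν)
  have hs' : ∀ ν : ℝ, 0 < ν → ν ≤ 1 → ∀ k : ℕ,
      DifferentiableOn ℝ (iteratedDeriv k (g (δ * ν))) (Ioi 0) :=
    fun ν hν hν1 k => hs (δ * ν) (hδν ν hν hν1).1 (hδν ν hν hν1).2.1 k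
  have hb' : ∀ a b : ℝ, 0 < a → a < b → ∃ C : ℝ, 0 < C ∧ ∀ ν : ℝ, 0 < ν → ν ≤ 1 →
      ∀ k : ℕ, 1 ≤ k → ∀ x ∈ Icc a b,
        |iteratedDeriv k (g (δ * ν)) x| ≤ C ^ (k + 1) * (k.factorial : ℝ) := by
    intro a b ha hab
    -- enlarge [a, b] so that it contains both seed points
    have ha' : 0 < min a (T₀ / 3) := lt_min ha (by positivity)
    have hab' : min a (T₀ / 3) < max b (2 * T₀ / 3) :=
      (min_le_left _ _).trans_lt (hab.trans_le (le_max_left _ _))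
    obtain ⟨C, hC, hCb⟩ := hb (min a (T₀ / 3)) (max b (2 * T₀ / 3)) ha' hab'
    set B : ℝ := (|L₂| + 1 + (|L₁| + 1)) / (2 * T₀ / 3 - T₀ / 3) +
      C ^ 3 * 2 * (max b (2 * T₀ / 3) - min a (T₀ / 3)) with hBdef
    set C' : ℝ := max (max C 1) B with hC'def
    have hC'1 : 1 ≤ C' := (le_max_right C 1).trans (le_max_left _ _)
    have hC'C : C ≤ C' := (le_max_left C 1).trans (le_max_left _ _)
    refine ⟨C', lt_of_lt_of_le one_pos hC'1, ?_⟩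
    intro ν hν hν1 k hk x hx
    have hx' : x ∈ Icc (min a (T₀ / 3)) (max b (2 * T₀ / 3)) :=
      ⟨(min_le_left _ _).trans hx.1, hx.2.trans (le_max_left _ _)⟩
    obtain ⟨hν', hν'1, -⟩ := hδν ν hν hν1
    rcases Nat.lt_or_ge k 2 with hk2 | hk2
    · obtain rfl : k = 1 := by omega
      rw [iteratedDeriv_one]
      -- the mean-value bound on the first derivative
      have hd0 : DifferentiableOn ℝ (g (δ * ν)) (Ioi 0) := by
        have := hs (δ * ν) hν' hν'1 0
        rwa [iteratedDeriv_zero] at this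
      have hd1 : DifferentiableOn ℝ (deriv (g (δ * ν))) (Ioi 0) := by
        have := hs (δ * ν) hν' hν'1 1
        rwa [iteratedDeriv_one] at this
      have hM : ∀ y ∈ Icc (min a (T₀ / 3)) (max b (2 * T₀ / 3)),
          |deriv (deriv (g (δ * ν))) y| ≤ C ^ 3 * 2 := by
        intro y hy
        have := hCb (δ * ν) hν' hν'1 2 le_rfl y hy
        rw [iteratedDeriv_two_eq] at this
        simpa [Nat.factorial] using this
      have key := abs_deriv_le_of_two_points ha' (min_le_right _ _) h12 (le_max_right _ _)
        hd0 hd1 hM hx'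
      have hB : |deriv (g (δ * ν)) x| ≤ B := by
        refine key.trans ?_
        rw [hBdef]
        have := (hbd ν hν hν1).1
        have := (hbd ν hν hν1).2
        have hpos : 0 < 2 * T₀ / 3 - T₀ / 3 := by linarith
        gcongr
      calc |deriv (g (δ * ν)) x| ≤ B := hB
        _ ≤ C' := le_max_right _ _
        _ = C' * 1 := (mul_one _).symm
        _ ≤ C' * C' := mul_le_mul_of_nonneg_left hC'1 (zero_le_one.trans hC'1)
        _ = C' ^ (1 + 1) * ((1:ℕ).factorial : ℝ) := by simp [pow_two]
    · calc |iteratedDeriv k (g (δ * ν)) x| ≤ C ^ (k + 1) * (k.factorial : ℝ) :=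
            hCb (δ * ν) hν' hν'1 k hk2 x hx'
        _ ≤ C' ^ (k + 1) * (k.factorial : ℝ) :=
            mul_le_mul_of_nonneg_right (pow_le_pow_left₀ hC.le hC'C _) (Nat.cast_nonneg _)
  have hc' : ∀ T : ℝ, 0 < T → T < T₀ →
      ∃ L : ℝ, Tendsto (fun ν : ℝ => g (δ * ν) T) (𝓝[>] 0) (𝓝 L) := by
    intro T' hT' hlt
    obtain ⟨L, hL⟩ := hc T' hT' hlt
    exact ⟨L, hL.comp (tendsto_const_mul_nhdsGT hδpos)⟩
  -- apply the k ≥ 1 statement to the rescaled family and scale back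
  obtain ⟨L, hL⟩ := hV (fun ν => g (δ * ν)) T₀ hT₀ hs' hb' hc' T hT
  refine ⟨L, ?_⟩
  have h := hL.comp (tendsto_const_mul_nhdsGT (inv_pos.2 hδpos))
  refine h.congr fun ν => ?_
  simp only [Function.comp_apply, mul_inv_cancel_left₀ hδpos.ne']

/-! ## The composition WITHOUT K1 (sorry-free) -/

/-- From the convergence of `T⁻² A(ν) → κ > 0` to the convergence of `log A(ν) → log (T² κ)`
(copied from the skeleton). -/
theorem tendsto_log_of_tendsto_inv_sq_mul {A : ℝ → ℝ} {T κ : ℝ} (hT : 0 < T) (hκ : 0 < κ)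
    (h : Tendsto (fun ν : ℝ => (T ^ 2)⁻¹ * A ν) (𝓝[>] 0) (𝓝 κ)) :
    Tendsto (fun ν : ℝ => Real.log (A ν)) (𝓝[>] 0) (𝓝 (Real.log (T ^ 2 * κ))) := by
  have hT2 : T ^ 2 ≠ 0 := pow_ne_zero 2 hT.ne'
  have hA : Tendsto A (𝓝[>] 0) (𝓝 (T ^ 2 * κ)) := by
    have := h.const_mul (T ^ 2)
    refine this.congr' (Eventually.of_forall fun ν => ?_)
    simp only [← mul_assoc, mul_inv_cancel₀ hT2, one_mul]
  exact hA.log (mul_pos (pow_pos hT 2) hκ).ne'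

/-- From the convergence of `log A(ν) → L` (with `A > 0` for `ν > 0`) to `T⁻² A(ν) → T⁻² e^L`
(copied from the skeleton). -/
theorem tendsto_inv_sq_mul_of_tendsto_log {A : ℝ → ℝ} {T L : ℝ}
    (hpos : ∀ ν : ℝ, 0 < ν → 0 < A ν)
    (h : Tendsto (fun ν : ℝ => Real.log (A ν)) (𝓝[>] 0) (𝓝 L)) :
    Tendsto (fun ν : ℝ => (T ^ 2)⁻¹ * A ν) (𝓝[>] 0) (𝓝 ((T ^ 2)⁻¹ * Real.exp L)) := by
  have hexp : Tendsto (fun ν : ℝ => Real.exp (Real.log (A ν))) (𝓝[>] 0) (𝓝 (Real.exp L)) :=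
    (Real.continuous_exp.tendsto L).comp h
  have hA : Tendsto A (𝓝[>] 0) (𝓝 (Real.exp L)) := by
    refine hexp.congr' ?_
    filter_upwards [self_mem_nhdsWithin] with ν hν
    exact Real.exp_log (hpos ν hν)
  exact hA.const_mul ((T ^ 2)⁻¹)

/-- **`continuation_without_K1`** — the skeleton's composition with the K1 hypothesis `hK` DELETED:
the statements of Stubs 1, 2, 4, 5 imply the crux, unfolded. Stub 5 (`RealVitali 1`) is first
upgraded to `RealVitali 2` (`realVitali_two_of_one`), which consumes the tower's `k ≥ 2` bounds
directly. -/
theorem continuation_without_K1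
    (hF : ∀ ω₂ lam β γ : ℝ, 0 < ω₂ → 0 < lam → 0 < β → 0 < γ →
      ∃ (μ : ℝ → Measure ChainConfig) (D : InfiniteChainDynamics (pinnedChain ω₂ lam β γ)),
        (D.carrier = (pinnedChain ω₂ lam β γ).bmGood ∧
          ∀ T : ℝ, 0 < T →
            (pinnedChain ω₂ lam β γ).IsChainGibbsMeasure T (μ T) ∧ IsShiftInvariant (μ T) ∧
            (pinnedChain ω₂ lam β γ).HasSuperstabilityEstimate (μ T) ∧ D.PreservesMeasure (μ T) ∧
            (∀ t : ℝ, D.HasAbsConvergentCorrelation (μ T) t) ∧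
            (∀ ν : ℝ, 0 < ν →
              0 < ∫ t in Ioi (0:ℝ), Real.exp (-(ν * t)) * D.currentCorrelation (μ T) t)))
    (hS : ∀ ω₂ lam β γ : ℝ, 0 < ω₂ → 0 < lam → 0 < β → 0 < γ →
      ∀ (μ : ℝ → Measure ChainConfig) (D : InfiniteChainDynamics (pinnedChain ω₂ lam β γ)),
        (D.carrier = (pinnedChain ω₂ lam β γ).bmGood ∧
          ∀ T : ℝ, 0 < T →
            (pinnedChain ω₂ lam β γ).IsChainGibbsMeasure T (μ T) ∧ IsShiftInvariant (μ T) ∧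
            (pinnedChain ω₂ lam β γ).HasSuperstabilityEstimate (μ T) ∧ D.PreservesMeasure (μ T) ∧
            (∀ t : ℝ, D.HasAbsConvergentCorrelation (μ T) t) ∧
            (∀ ν : ℝ, 0 < ν →
              0 < ∫ t in Ioi (0:ℝ), Real.exp (-(ν * t)) * D.currentCorrelation (μ T) t)) →
        ∀ T : ℝ, 0 < T →
          (∃ (μT : Measure ChainConfig) (D' : InfiniteChainDynamics (pinnedChain ω₂ lam β γ)) (κ : ℝ),
            (pinnedChain ω₂ lam β γ).IsChainGibbsMeasure T μT ∧ D'.PreservesMeasure μT ∧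
            (∀ t : ℝ, D'.HasAbsConvergentCorrelation μT t) ∧ 0 < κ ∧
            Tendsto (fun ν : ℝ => (T ^ 2)⁻¹ *
              ∫ t in Ioi (0:ℝ), Real.exp (-(ν * t)) * D'.currentCorrelation μT t) (𝓝[>] 0) (𝓝 κ)) →
          ∃ κ : ℝ, 0 < κ ∧ Tendsto (fun ν : ℝ => (T ^ 2)⁻¹ *
            ∫ t in Ioi (0:ℝ), Real.exp (-(ν * t)) * D.currentCorrelation (μ T) t) (𝓝[>] 0) (𝓝 κ))
    (hG : ∀ ω₂ lam β γ : ℝ, 0 < ω₂ → 0 < lam → 0 < β → 0 < γ →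
      ∀ (μ : ℝ → Measure ChainConfig) (D : InfiniteChainDynamics (pinnedChain ω₂ lam β γ)),
        (D.carrier = (pinnedChain ω₂ lam β γ).bmGood ∧
          ∀ T : ℝ, 0 < T →
            (pinnedChain ω₂ lam β γ).IsChainGibbsMeasure T (μ T) ∧ IsShiftInvariant (μ T) ∧
            (pinnedChain ω₂ lam β γ).HasSuperstabilityEstimate (μ T) ∧ D.PreservesMeasure (μ T) ∧
            (∀ t : ℝ, D.HasAbsConvergentCorrelation (μ T) t) ∧
            (∀ ν : ℝ, 0 < ν →
              0 < ∫ t in Ioi (0:ℝ), Real.exp (-(ν * t)) * D.currentCorrelation (μ T) t)) →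
        (∀ ν : ℝ, 0 < ν → ν ≤ 1 → ∀ k : ℕ, DifferentiableOn ℝ (iteratedDeriv k (fun T : ℝ => Real.log
          (∫ t in Ioi (0:ℝ), Real.exp (-(ν * t)) * D.currentCorrelation (μ T) t))) (Ioi 0)) ∧
        ∀ a b : ℝ, 0 < a → a < b → ∃ C : ℝ, 0 < C ∧ ∀ ν : ℝ, 0 < ν → ν ≤ 1 →
          ∀ k : ℕ, 2 ≤ k → ∀ T ∈ Icc a b,
            |iteratedDeriv k (fun T : ℝ => Real.log
              (∫ t in Ioi (0:ℝ), Real.exp (-(ν * t)) * D.currentCorrelation (μ T) t)) T| ≤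
              C ^ (k + 1) * (k.factorial : ℝ))
    (hV : ∀ (g : ℝ → ℝ → ℝ) (T₀ : ℝ), 0 < T₀ →
      (∀ ν : ℝ, 0 < ν → ν ≤ 1 → ∀ k : ℕ, DifferentiableOn ℝ (iteratedDeriv k (g ν)) (Ioi 0)) →
      (∀ a b : ℝ, 0 < a → a < b → ∃ C : ℝ, 0 < C ∧ ∀ ν : ℝ, 0 < ν → ν ≤ 1 →
        ∀ k : ℕ, 1 ≤ k → ∀ T ∈ Icc a b, |iteratedDeriv k (g ν) T| ≤ C ^ (k + 1) * (k.factorial : ℝ)) →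
      (∀ T : ℝ, 0 < T → T < T₀ → ∃ L : ℝ, Tendsto (fun ν : ℝ => g ν T) (𝓝[>] 0) (𝓝 L)) →
      ∀ T : ℝ, 0 < T → ∃ L : ℝ, Tendsto (fun ν : ℝ => g ν T) (𝓝[>] 0) (𝓝 L)) :
    ∀ ω₂ lam β γ : ℝ, 0 < ω₂ → 0 < lam → 0 < β → 0 < γ → ∀ T₀ : ℝ, 0 < T₀ →
      (∀ T : ℝ, 0 < T → T < T₀ →
        ∃ (μT : MeasureTheory.Measure
              Literature.MathematicalPhysics.KineticTheory.HeatConduction.ChainConfig)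
          (D : Literature.MathematicalPhysics.KineticTheory.HeatConduction.InfiniteChainDynamics
            (Literature.MathematicalPhysics.KineticTheory.HeatConduction.pinnedChain ω₂ lam β γ))
          (κ : ℝ),
          (Literature.MathematicalPhysics.KineticTheory.HeatConduction.pinnedChain
              ω₂ lam β γ).IsChainGibbsMeasure T μT ∧ D.PreservesMeasure μT ∧
          (∀ t : ℝ, D.HasAbsConvergentCorrelation μT t) ∧ 0 < κ ∧
          Filter.Tendsto (fun ν : ℝ => (T ^ 2)⁻¹ *
            MeasureTheory.integral (MeasureTheory.volume.restrict (Set.Ioi (0:ℝ)))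
              (fun t : ℝ => Real.exp (-(ν * t)) * D.currentCorrelation μT t))
            (nhdsWithin (0:ℝ) (Set.Ioi 0)) (nhds κ)) →
      ∀ T : ℝ, 0 < T →
        ∃ (μT : MeasureTheory.Measure
              Literature.MathematicalPhysics.KineticTheory.HeatConduction.ChainConfig)
          (D : Literature.MathematicalPhysics.KineticTheory.HeatConduction.InfiniteChainDynamics
            (Literature.MathematicalPhysics.KineticTheory.HeatConduction.pinnedChain ω₂ lam β γ))
          (κ : ℝ),
          (Literature.MathematicalPhysics.KineticTheory.HeatConduction.pinnedChain
              ω₂ lam β γ).IsChainGibbsMeasure T μT ∧ D.PreservesMeasure μT ∧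
          (∀ t : ℝ, D.HasAbsConvergentCorrelation μT t) ∧ 0 < κ ∧
          Filter.Tendsto (fun ν : ℝ => (T ^ 2)⁻¹ *
            MeasureTheory.integral (MeasureTheory.volume.restrict (Set.Ioi (0:ℝ)))
              (fun t : ℝ => Real.exp (-(ν * t)) * D.currentCorrelation μT t))
            (nhdsWithin (0:ℝ) (Set.Ioi 0)) (nhds κ) := by
  -- upgrade Stub 5 to its k ≥ 2 form
  have hV2 : RealVitali 2 := realVitali_two_of_one hV
  intro ω₂ lam β γ hω hl hβ hγ T₀ hT₀ hcorner T hT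
  -- Stub 1: the regular thermal family (one flow, moving Gibbs measure)
  obtain ⟨μ, D, hreg⟩ := hF ω₂ lam β γ hω hl hβ hγ
  have hRT := hreg.2
  have hApos : ∀ T' : ℝ, 0 < T' → ∀ ν : ℝ, 0 < ν →
      0 < ∫ t in Ioi (0:ℝ), Real.exp (-(ν * t)) * D.currentCorrelation (μ T') t :=
    fun T' hT' => (hRT T' hT').2.2.2.2.2
  -- Stub 2 on the corner: the canonical log-Abel functional converges at every T' < T₀
  have hseed : ∀ T' : ℝ, 0 < T' → T' < T₀ → ∃ L : ℝ, Tendsto (fun ν : ℝ => Real.log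
      (∫ t in Ioi (0:ℝ), Real.exp (-(ν * t)) * D.currentCorrelation (μ T') t)) (𝓝[>] 0) (𝓝 L) := by
    intro T' hT' hlt
    obtain ⟨κ', hκ', hlim⟩ := hS ω₂ lam β γ hω hl hβ hγ μ D hreg T' hT' (hcorner T' hT' hlt)
    exact ⟨_, tendsto_log_of_tendsto_inv_sq_mul hT' hκ' hlim⟩
  -- Stub 4: smoothness and the k ≥ 2 factorial bounds, ν-uniform on compacts
  obtain ⟨hsmooth, hGk⟩ := hG ω₂ lam β γ hω hl hβ hγ μ D hreg
  -- Stub 5 in its k ≥ 2 form: propagation of the convergence of log A to every temperature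
  obtain ⟨L, hL⟩ := hV2 (fun ν T'' => Real.log
      (∫ t in Ioi (0:ℝ), Real.exp (-(ν * t)) * D.currentCorrelation (μ T'') t))
    T₀ hT₀ hsmooth hGk hseed T hT
  -- exponentiate and read off the witness
  refine ⟨μ T, D, (T ^ 2)⁻¹ * Real.exp L, (hRT T hT).1, (hRT T hT).2.2.2.1,
    (hRT T hT).2.2.2.2.1, mul_pos (inv_pos.mpr (pow_pos hT 2)) (Real.exp_pos L), ?_⟩
  exact tendsto_inv_sq_mul_of_tendsto_log (hApos T hT) hL

/-- **The crux BY NAME from the four statements** (Stubs 1, 2, 4, 5 of the registered skeleton,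
verbatim up to `open`ed namespaces): the lead may re-register the skeleton without
`stub_thermalExponent`. -/
theorem GreenKuboContinuation_of_four
    (h1 : ∀ ω₂ lam β γ : ℝ, 0 < ω₂ → 0 < lam → 0 < β → 0 < γ →
      ∃ (μ : ℝ → Measure ChainConfig) (D : InfiniteChainDynamics (pinnedChain ω₂ lam β γ)),
        (D.carrier = (pinnedChain ω₂ lam β γ).bmGood ∧
          ∀ T : ℝ, 0 < T →
            (pinnedChain ω₂ lam β γ).IsChainGibbsMeasure T (μ T) ∧ IsShiftInvariant (μ T) ∧
            (pinnedChain ω₂ lam β γ).HasSuperstabilityEstimate (μ T) ∧ D.PreservesMeasure (μ T) ∧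
            (∀ t : ℝ, D.HasAbsConvergentCorrelation (μ T) t) ∧
            (∀ ν : ℝ, 0 < ν →
              0 < ∫ t in Ioi (0:ℝ), Real.exp (-(ν * t)) * D.currentCorrelation (μ T) t)))
    (h2 : ∀ ω₂ lam β γ : ℝ, 0 < ω₂ → 0 < lam → 0 < β → 0 < γ →
      ∀ (μ : ℝ → Measure ChainConfig) (D : InfiniteChainDynamics (pinnedChain ω₂ lam β γ)),
        (D.carrier = (pinnedChain ω₂ lam β γ).bmGood ∧
          ∀ T : ℝ, 0 < T →
            (pinnedChain ω₂ lam β γ).IsChainGibbsMeasure T (μ T) ∧ IsShiftInvariant (μ T) ∧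
            (pinnedChain ω₂ lam β γ).HasSuperstabilityEstimate (μ T) ∧ D.PreservesMeasure (μ T) ∧
            (∀ t : ℝ, D.HasAbsConvergentCorrelation (μ T) t) ∧
            (∀ ν : ℝ, 0 < ν →
              0 < ∫ t in Ioi (0:ℝ), Real.exp (-(ν * t)) * D.currentCorrelation (μ T) t)) →
        ∀ T : ℝ, 0 < T →
          (∃ (μT : Measure ChainConfig) (D' : InfiniteChainDynamics (pinnedChain ω₂ lam β γ)) (κ : ℝ),
            (pinnedChain ω₂ lam β γ).IsChainGibbsMeasure T μT ∧ D'.PreservesMeasure μT ∧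
            (∀ t : ℝ, D'.HasAbsConvergentCorrelation μT t) ∧ 0 < κ ∧
            Tendsto (fun ν : ℝ => (T ^ 2)⁻¹ *
              ∫ t in Ioi (0:ℝ), Real.exp (-(ν * t)) * D'.currentCorrelation μT t) (𝓝[>] 0) (𝓝 κ)) →
          ∃ κ : ℝ, 0 < κ ∧ Tendsto (fun ν : ℝ => (T ^ 2)⁻¹ *
            ∫ t in Ioi (0:ℝ), Real.exp (-(ν * t)) * D.currentCorrelation (μ T) t) (𝓝[>] 0) (𝓝 κ))
    (h4 : ∀ ω₂ lam β γ : ℝ, 0 < ω₂ → 0 < lam → 0 < β → 0 < γ →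
      ∀ (μ : ℝ → Measure ChainConfig) (D : InfiniteChainDynamics (pinnedChain ω₂ lam β γ)),
        (D.carrier = (pinnedChain ω₂ lam β γ).bmGood ∧
          ∀ T : ℝ, 0 < T →
            (pinnedChain ω₂ lam β γ).IsChainGibbsMeasure T (μ T) ∧ IsShiftInvariant (μ T) ∧
            (pinnedChain ω₂ lam β γ).HasSuperstabilityEstimate (μ T) ∧ D.PreservesMeasure (μ T) ∧
            (∀ t : ℝ, D.HasAbsConvergentCorrelation (μ T) t) ∧
            (∀ ν : ℝ, 0 < ν →
              0 < ∫ t in Ioi (0:ℝ), Real.exp (-(ν * t)) * D.currentCorrelation (μ T) t)) →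
        (∀ ν : ℝ, 0 < ν → ν ≤ 1 → ∀ k : ℕ, DifferentiableOn ℝ (iteratedDeriv k (fun T : ℝ => Real.log
          (∫ t in Ioi (0:ℝ), Real.exp (-(ν * t)) * D.currentCorrelation (μ T) t))) (Ioi 0)) ∧
        ∀ a b : ℝ, 0 < a → a < b → ∃ C : ℝ, 0 < C ∧ ∀ ν : ℝ, 0 < ν → ν ≤ 1 →
          ∀ k : ℕ, 2 ≤ k → ∀ T ∈ Icc a b,
            |iteratedDeriv k (fun T : ℝ => Real.log
              (∫ t in Ioi (0:ℝ), Real.exp (-(ν * t)) * D.currentCorrelation (μ T) t)) T| ≤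
              C ^ (k + 1) * (k.factorial : ℝ))
    (h5 : ∀ (g : ℝ → ℝ → ℝ) (T₀ : ℝ), 0 < T₀ →
      (∀ ν : ℝ, 0 < ν → ν ≤ 1 → ∀ k : ℕ, DifferentiableOn ℝ (iteratedDeriv k (g ν)) (Ioi 0)) →
      (∀ a b : ℝ, 0 < a → a < b → ∃ C : ℝ, 0 < C ∧ ∀ ν : ℝ, 0 < ν → ν ≤ 1 →
        ∀ k : ℕ, 1 ≤ k → ∀ T ∈ Icc a b, |iteratedDeriv k (g ν) T| ≤ C ^ (k + 1) * (k.factorial : ℝ)) →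
      (∀ T : ℝ, 0 < T → T < T₀ → ∃ L : ℝ, Tendsto (fun ν : ℝ => g ν T) (𝓝[>] 0) (𝓝 L)) →
      ∀ T : ℝ, 0 < T → ∃ L : ℝ, Tendsto (fun ν : ℝ => g ν T) (𝓝[>] 0) (𝓝 L)) :
    Summit.AtomisticToContinuum.FouriersLaw.Theses.EmbeddedDrudeMourre.GreenKuboContinuation :=
  continuation_without_K1 h1 h2 h4 h5

end Summit.AtomisticToContinuum.FouriersLaw.Cruxes.GreenKuboContinuation.Drefute

end
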